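import Summits.QuantumFields.YangMills.Theorems.UnitScaleTiltBlockAvgCorrector
import HarnessLib

/-!
# Route `UnitScaleTilt`, crux K1 «MinimiserStabilityRegPr» (stmt-QuantumFields-19200), stub `stub_prop8` (V2) — sub-lemma V2-EL, part 7a:
# **THE SELECTIVE EXACT CORRECTOR** for Bałaban's block averaging (0.4) with the printed exp-mean-log average on `SU(N)`

Cell `ym3-torus` ∕ fleet seat `ym-ust-19200-p2` g4.  The exact corrector `BlockAvgCorrector.exists_avgFun_eq_of_near` (p448916) re-solves EVERY central
crossing bond.  For the k-fold tangent space of the (0.4) fibre (parts 7b–7d: tangent vectors supported on the ITERATED central bonds) one needs the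
corrector to leave the central bond `β(c)` untouched whenever the target already agrees with the average at `c`.  Since the fibre equations decouple
in the private coordinates `W_c = pre·U(β c)·post` (`BlockAveragingEMLHaarAC.avgFun_update_centralBond_self`, `T4TriangularPushforward.apply_resample_eq`),
this is the same proof with the trivial solution `W_c = axialAvg U c` chosen at the untouched `c`.  Sorry-free, no definition. [folklore]
References: T. Bałaban, CMP 109 (1987) 249–301 [Balaban1987RG1] ((0.4) p.253); CMP 102 (1985) 277–309 [Balaban1985Variational] (p.300).
-/

noncomputable section

open scoped Matrix.Norms.L2Operator
open NormedSpace Function Set Filter Topology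

namespace Summit.QuantumFields.YangMills.Theorems.Prop8Criticality

open Literature.MathematicalPhysics.QuantumFieldTheory.Balaban1983to89
open MatrixLog ExpMeanLog
open BlockAveraging BlockAveragingHaarAC BlockAveragingEMLHaarAC LatticeWordStokes AveragingRT T4Continuum
open Summit.QuantumFields.YangMills.Theorems.BlockAvgCorrector (stokesConst stokesConst_nonneg emlWeight_pos emlWeight_le_one
  sum_emlWeight_le norm_openHol_mul_star_sub_one_le exists_eq_of_near)

section Selective

variable {P : Params} {j : ℕ} {n : Type*} [Fintype n] [DecidableEq n] [Nonempty n]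

/-- A special unitary matrix has operator norm `1` (nonempty index type). [folklore] -/
private theorem norm_coe_su' (g : Matrix.specialUnitaryGroup n ℂ) : ‖(g : Matrix n n ℂ)‖ = 1 :=
  UnitaryModel.norm_of_mem_unitaryGroup (Matrix.specialUnitaryGroup_le_unitaryGroup g.2)

/-- Left multiplication by a special unitary does not increase the norm. [folklore] -/
private theorem norm_coe_mul_le' (g : Matrix.specialUnitaryGroup n ℂ) (A : Matrix n n ℂ) :
    ‖(g : Matrix n n ℂ) * A‖ ≤ ‖A‖ :=
  (norm_mul_le _ _).trans (by rw [norm_coe_su', one_mul])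

/-- Right multiplication by a special unitary does not increase the norm. [folklore] -/
private theorem norm_mul_coe_le' (A : Matrix n n ℂ) (g : Matrix.specialUnitaryGroup n ℂ) :
    ‖A * (g : Matrix n n ℂ)‖ ≤ ‖A‖ :=
  (norm_mul_le _ _).trans (by rw [norm_coe_su', mul_one])

/-- **THE SELECTIVE EXACT CORRECTOR.**  On a torus in the standing range `j + 1 ≤ m + K`: if `U` is `t`-small and the coarse field `V` is `η`-close
to `Ū` bond by bond, with `stokesConst·t + 2η|I| ≤ |I|⁻¹/16` and `< δ_N`, then `V = Ū′` EXACTLY for a configuration `U′` that agrees with `U` off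
the central crossing bonds, moves each central bond by at most `2η|I|`, AND AGREES WITH `U` AT THE CENTRAL BOND `β(c)` OF EVERY COARSE BOND `c` WHERE
THE TARGET IS ALREADY MET (`V(c) = Ū(c)`).  (As `BlockAvgCorrector.exists_avgFun_eq_of_near`, choosing the trivial solution of the decoupled fibre
equation at such `c`.) [cite: Balaban1987RG1, (0.4) p.253] -/
theorem exists_avgFun_eq_of_near_selective (hj : j + 1 ≤ P.m + P.K) {t η : ℝ} (ht : 0 ≤ t) (hη : 0 ≤ η)
    (hsmall : stokesConst P * t + 2 * η / emlWeight P ≤ emlWeight P / 16)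
    (hguard : stokesConst P * t + 2 * η / emlWeight P < (expMeanLogSU (n := n)).δ)
    (U : GaugeField P j (Matrix.specialUnitaryGroup n ℂ)) (hU : PlaqSmall t U)
    (V : GaugeField P (j+1) (Matrix.specialUnitaryGroup n ℂ))
    (hV : ∀ c, ‖((V c : Matrix.specialUnitaryGroup n ℂ) : Matrix n n ℂ) -
      ((avgFun (expMeanLogSU (n := n)) U c : Matrix.specialUnitaryGroup n ℂ) : Matrix n n ℂ)‖ ≤ η) :
    ∃ U' : GaugeField P j (Matrix.specialUnitaryGroup n ℂ),
      avgFun (expMeanLogSU (n := n)) U' = V ∧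
      (∀ b, (∀ c, centralBond c ≠ b) → U' b = U b) ∧
      (∀ c, V c = avgFun (expMeanLogSU (n := n)) U c → U' (centralBond c) = U (centralBond c)) ∧
      ∀ b, ‖((U' b : Matrix.specialUnitaryGroup n ℂ) : Matrix n n ℂ) - (U b : Matrix n n ℂ)‖ ≤ 2 * η / emlWeight P := by
  classical
  have hκ := emlWeight_pos P
  have hκ1 := emlWeight_le_one P
  set R : ℝ := 2 * η / emlWeight P with hR_def
  have hR0 : 0 ≤ R := div_nonneg (by positivity) hκ.le
  have hr₀ : 0 ≤ stokesConst P * t := mul_nonneg (stokesConst_nonneg P) ht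
  -- the ball of radius `R` about `W₀ = U(c)` lies in the guard
  have hball : ∀ (c : PBond P (j+1)) (W : Matrix.specialUnitaryGroup n ℂ),
      ‖(W : Matrix n n ℂ) - ((axialAvg U c : Matrix.specialUnitaryGroup n ℂ) : Matrix n n ℂ)‖ ≤ R →
        W ∈ fibreGuard (expMeanLogSU (n := n)) U c := by
    intro c W hW i
    by_cases hci : IsCentral c i
    · rw [fibreFamily_of_isCentral U c W i hci, GaugeGroup.dist1_one]; exact (expMeanLogSU (n := n)).δ_pos
    · rw [dist1_fibreFamily_of_not_isCentral U c W i hci]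
      have h1 : ((openHol U c i : Matrix.specialUnitaryGroup n ℂ) : Matrix n n ℂ) * star (W : Matrix n n ℂ) - 1 =
          (((openHol U c i : Matrix.specialUnitaryGroup n ℂ) : Matrix n n ℂ) * star ((axialAvg U c : Matrix.specialUnitaryGroup n ℂ) : Matrix n n ℂ) - 1) +
            ((openHol U c i : Matrix.specialUnitaryGroup n ℂ) : Matrix n n ℂ) * star ((W : Matrix n n ℂ) - ((axialAvg U c : Matrix.specialUnitaryGroup n ℂ) : Matrix n n ℂ)) := by
        rw [star_sub]; noncomm_ring
      rw [h1]
      refine (norm_add_le _ _).trans_lt ?_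
      have h2 := norm_openHol_mul_star_sub_one_le ht hU c i
      have h3 : ‖((openHol U c i : Matrix.specialUnitaryGroup n ℂ) : Matrix n n ℂ) * star ((W : Matrix n n ℂ) - ((axialAvg U c : Matrix.specialUnitaryGroup n ℂ) : Matrix n n ℂ))‖ ≤ R :=
        (norm_coe_mul_le' _ _).trans (by rw [norm_star]; exact hW)
      show _ < (expMeanLogSU (n := n)).δ
      linarith
  -- the trivial solution: `K(axialAvg U c) = Ū(c)`
  have htriv : ∀ c : PBond P (j+1), (expMeanLogSU (n := n)).avg (fibreFamily U c (axialAvg U c)) * axialAvg U c =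
      avgFun (expMeanLogSU (n := n)) U c := by
    intro c
    have hmem : axialAvg U c ∈ fibreGuard (expMeanLogSU (n := n)) U c := hball c _ (by rw [sub_self, norm_zero]; exact hR0)
    rw [← fibreMap_of_mem _ U c hmem, axialAvg_eq_pre_mul_mul_post U c, ← avgFun_update_centralBond_self hj, update_eq_self]
  -- the fibre equation at each coarse bond, solved trivially where the target is already met
  have hfib : ∀ c : PBond P (j+1), ∃ W : Matrix.specialUnitaryGroup n ℂ,
      ‖(W : Matrix n n ℂ) - ((axialAvg U c : Matrix.specialUnitaryGroup n ℂ) : Matrix n n ℂ)‖ ≤ R ∧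
        W ∈ fibreGuard (expMeanLogSU (n := n)) U c ∧
        (expMeanLogSU (n := n)).avg (fibreFamily U c W) * W = V c ∧
        (V c = avgFun (expMeanLogSU (n := n)) U c → W = axialAvg U c) := by
    intro c
    by_cases hc : V c = avgFun (expMeanLogSU (n := n)) U c
    · refine ⟨axialAvg U c, by rw [sub_self, norm_zero]; exact hR0, hball c _ (by rw [sub_self, norm_zero]; exact hR0), ?_, fun _ => rfl⟩
      rw [htriv c, hc]
    · have hY : ‖((V c : Matrix.specialUnitaryGroup n ℂ) : Matrix n n ℂ) -
          (((expMeanLogSU (n := n)).avg (fibreFamily U c (axialAvg U c)) * axialAvg U c : Matrix.specialUnitaryGroup n ℂ) : Matrix n n ℂ)‖ ≤ η := by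
        rw [htriv c]; exact hV c
      obtain ⟨W, hW, hKW⟩ := exists_eq_of_near (offHol U c) (fun _ => (emlWeight_pos P).le) hκ hκ1 (sum_emlWeight_le c)
        (K := fun W => (expMeanLogSU (n := n)).avg (fibreFamily U c W) * W) (S := fibreGuard (expMeanLogSU (n := n)) U c)
        (fun W hW => coe_fibreCore_eq U c hW) hr₀ hη hsmall (hball c)
        (fun k => norm_openHol_mul_star_sub_one_le ht hU c _) hY
      exact ⟨W, hW, hball c W hW, hKW, fun h => absurd h hc⟩
  choose Wc hWR hWG hWK hWtriv using hfib
  -- the corrected private bonds and the resampled configuration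
  set g : PBond P (j+1) → Matrix.specialUnitaryGroup n ℂ := fun c => (pre U c)⁻¹ * Wc c * (post U c)⁻¹ with hg_def
  have hg : ∀ c, pre U c * g c * post U c = Wc c := by
    intro c; simp only [hg_def]; group
  have hUc : ∀ c, U (centralBond c) = (pre U c)⁻¹ * axialAvg U c * (post U c)⁻¹ := fun c => by
    rw [axialAvg_eq_pre_mul_mul_post]; group
  refine ⟨extend centralBond g U, ?_, ?_, ?_, ?_⟩
  · funext c
    rw [T4TriangularPushforward.apply_resample_eq (isLocal_avgFun hj _) (centralBond_injective hj) U g c,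
      avgFun_update_centralBond_self hj, hg c, fibreMap_of_mem _ U c (hWG c), hWK c]
  · intro b hb
    exact extend_apply' _ _ _ fun ⟨c, hc⟩ => hb c hc
  · intro c hc
    rw [(centralBond_injective hj).extend_apply, hUc c, hg_def]
    simp only [hWtriv c hc]
  · intro b
    by_cases hb : ∃ c, centralBond c = b
    · obtain ⟨c, rfl⟩ := hb
      rw [(centralBond_injective hj).extend_apply, hUc c, hg_def]
      simp only [Submonoid.coe_mul]
      rw [← sub_mul, ← mul_sub]
      exact (norm_mul_coe_le' _ _).trans ((norm_coe_mul_le' _ _).trans (hWR c))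
    · rw [extend_apply' _ _ _ hb, sub_self, norm_zero]; exact hR0

end Selective

end Summit.QuantumFields.YangMills.Theorems.Prop8Criticality

end
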